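import Literature.AlgebraicGeometry.Frobenioids.ModelFrobenioidStandard
import HarnessLib

/-!
# Frobenioids I, Theorem 5.2 (iii), second sentence — the `iff` modulo birational
# Frobenius-normalization

Mochizuki, *The geometry of Frobenioids I: the general theory*, Kyushu J. Math. **62** (2008)
293–400, §5, Theorem 5.2 (iii), kurims text p. 101, proof p. 103
[cite: MochizukiFrdI2008, Thm. 5.2(iii) p.101]:

  "`C` is of rationally standard type if and only if the following conditions are satisfied:
  (a) `C` is of rational and standard type; (b) `(C^un-tr)^birat` admits a Frobenius-compact
  object."

By Def. 4.5 (iii), "rationally standard type" is "(a′) birationally Frobenius-normalized, rational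
and standard type; (b) `(C^un-tr)^birat` admits a Frobenius-compact object"; so the content of the
sentence beyond Def. 4.5 (iii) is exactly the claim of its proof (p. 103): "every object of `C` [a
model Frobenioid] is birationally Frobenius-normalized".  This file proves the closed statement
`ModelFrobenioid.RationallyStandardTypeIff' Φ B DivB R` (`ModelFrobenioidStandard.lean`, seat
abc-iut-L1-t2) for every parameter `R : (data Φ B DivB).RSParams` WHOSE birationalization datum `R.B`
makes every object birationally Frobenius-normalized
(`PreFrobenioidData.IsOfBiratFrobenioidNormalizedType R.B`, seat abc-iut-L1-t3) — i.e. CONDITIONALLY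
on that named hypothesis, which is the p. 103 claim for THE birationalization `C → C^birat` of
Prop. 4.4 (to be supplied for the concrete `BiratData` instance of seats abc-iut-L6-t6/L6-t8); for a
junk datum `R.B` it can fail, which is why `RationallyStandardTypeIff'` is a schema in `R`.
-/

namespace Literature.AlgebraicGeometry.Frobenioids

open CategoryTheory Opposite

universe w v u

namespace ModelFrobenioid

variable {D : Type u} [Category.{v} D] (Φ B : Dᵒᵖ ⥤ CommMonCat.{w}) (DivB : B ⟶ monoidGp Φ)

/-- **Thm. 5.2 (iii)**, second sentence, for a parameter `R` under which every object of the model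
Frobenioid is birationally Frobenius-normalized (the claim of the printed proof, p. 103, for the
birationalization of Prop. 4.4): then "rationally standard type ⟺ (a) rational and standard type ∧
(b) `(C^un-tr)^birat` admits a Frobenius-compact object".  CONDITIONAL on the named hypothesis
`hR`. [cite: MochizukiFrdI2008, Thm. 5.2(iii) p.103] -/
theorem rationallyStandardTypeIff'_of_biratFrobeniusNormalized (R : (data Φ B DivB).RSParams)
    (hR : PreFrobenioidData.IsOfBiratFrobeniusNormalizedType R.B) :
    RationallyStandardTypeIff' Φ B DivB R := by
  intro _
  constructor
  · intro h
    exact ⟨⟨h.rational, h.standard⟩, h.frobCompact⟩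
  · rintro ⟨⟨hrat, hstd⟩, hfc⟩
    exact ⟨hR, hrat, hstd, hfc⟩

/-- Conversely, the `iff` of Thm. 5.2 (iii) at `R`, together with (a) and (b), FORCES birational
Frobenius-normalization with respect to `R.B` — so the hypothesis `hR` above is exactly the
content of the sentence beyond Def. 4.5 (iii). [cite: MochizukiFrdI2008, Thm. 5.2(iii) p.103] -/
theorem isOfBiratFrobeniusNormalizedType_of_rationallyStandardTypeIff' (h : Hypotheses Φ B)
    (R : (data Φ B DivB).RSParams) (hiff : RationallyStandardTypeIff' Φ B DivB R)
    (hrat : ∀ A : ModelFrobenioid Φ B DivB, PreFrobenioidData.IsRational R.B R.Supp A)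
    (hstd : (data Φ B DivB).IsOfStandardType)
    (hfc : ∃ Y : R.BU.Birat, R.BU.ops.IsFrobeniusCompact Y) :
    PreFrobenioidData.IsOfBiratFrobeniusNormalizedType R.B :=
  ((hiff h).mpr ⟨⟨hrat, hstd⟩, hfc⟩).biratFrobNormalized

end ModelFrobenioid

end Literature.AlgebraicGeometry.Frobenioids
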